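import Summits.QuantumFields.YangMills.Theorems.LuscherReductionOneSiteLevelsKacGreen

/-!
# INNER, flat lane (layer III): THE cut-off lemma — min–max levels from admissible families

Support module of crux `OneSiteLevels` (route `LuscherReduction`, item stmt-QuantumFields-20007), FLAT lane of the
registered v12 stub `stub_flatKacAL1` (STUB-PLAN rev 3 row G5, «the single cut-off lemma of the lane»).

`physLevel k` is an infimum over `k`-dimensional spaces of colour-invariant `C²_c` TRIAL functions.  The functions the
flat lane produces (AL1 eigenfunctions, heat-smoothed remainders) are admissible (`IsKacFn`) but not compactly supported.
This file proves the bridge (G5):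

  `physLevel_le_of_family`: if `g_0, …, g_n ∈ IsKacFn` are `L²`-orthonormal and the matrix `Q_ij = ∫ g_i · 𝔥 g_j` satisfies
  `Σ_ij a_i a_j Q_ij ≤ s Σ_i a_i²` for all coefficient vectors `a` (`0 ≤ s`), then `physLevel (n+1) ≤ s`.

Proof: cut off with the tree's radial cut-off `χ_R` (`radialCutoff_package`); the energy and Gram matrices of the cut-off family
`Q^R_ij = ∫ χ_R² g_i 𝔥g_j + ½ ∫ ‖∇χ_R‖² g_i g_j` (Agmon's localisation identity `energyForm_testFn_mul`) and `G^R_ij = ∫ χ_R² g_i g_j`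
converge to `Q_ij` and `δ_ij` as `R → ∞` (dominated convergence — only integrability is used, no decay RATE); for `R` large the
cut-off span is an `(n+1)`-dimensional admissible trial space with Rayleigh quotient `≤ s + ε`, so `s + ε ∈ levelSet (n+1)`.

* §1 dominated-convergence limits `∫ χ_R² φ → ∫ φ`, `∫ ‖∇χ_R‖² ψ → 0`;
* §2 bilinear expansions of the energy and the mass of a cut-off span (general `C²` family);
* §3 `physLevel_le_of_family`.

Real analysis only ([folklore]); NOT the stub; femto rung R2b1; NOT a claim about the gap.
References: S. Agmon (1982) (1.16); M. Reed, B. Simon IV, Thm. XIII.1–2.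
-/

set_option autoImplicit false

noncomputable section

open MeasureTheory Filter Topology Real
open Literature.Analysis.OperatorTheory.YMMatrixModel

namespace Summit.QuantumFields.YangMills.Theorems.FemtoTransferGap

/-! ### §1. The two cut-off limits -/

/-- For every `x`, eventually (in `R → ∞`) `χ_R(x) = 1`. [folklore] -/
theorem eventually_radialCutoff_eq_one (x : ZM) : ∀ᶠ R : ℝ in atTop, radialCutoff R x = 1 := by
  filter_upwards [eventually_ge_atTop (‖x‖ + 1)] with R hR
  exact radialCutoff_eq_one_of_lt (by linarith [norm_nonneg x]) (by linarith)

/-- `0 ≤ χ_R ≤ 1`, hence `χ_R² ≤ 1`. [folklore] -/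
theorem radialCutoff_sq_le_one (R : ℝ) (x : ZM) : radialCutoff R x ^ 2 ≤ 1 := by
  have h := radialCutoff_mem_Icc R x
  nlinarith [h.1, h.2]

/-- **`∫ χ_R² φ → ∫ φ`** as `R → ∞`, for continuous integrable `φ` (dominated convergence, dominant `|φ|`). [folklore] -/
theorem tendsto_integral_radialCutoff_sq_mul {φ : ZM → ℝ} (hφc : Continuous φ) (hφ : Integrable φ) :
    Tendsto (fun R : ℝ => ∫ x, radialCutoff R x ^ 2 * φ x) atTop (𝓝 (∫ x, φ x)) := by
  refine tendsto_integral_filter_of_dominated_convergence (fun x => ‖φ x‖)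
    (Eventually.of_forall fun R => ?_) (Eventually.of_forall fun R => ae_of_all _ fun x => ?_) hφ.norm
    (ae_of_all _ fun x => ?_)
  · exact (((radialCutoff_contDiff R (n := 2)).continuous.fun_pow 2).fun_mul hφc).aestronglyMeasurable
  · rw [norm_mul, Real.norm_eq_abs, abs_of_nonneg (sq_nonneg _)]
    exact mul_le_of_le_one_left (norm_nonneg _) (radialCutoff_sq_le_one R x)
  · refine tendsto_const_nhds.congr' ?_
    filter_upwards [eventually_radialCutoff_eq_one x] with R hR
    rw [hR, one_pow, one_mul]

/-- **`∫ ‖∇χ_R‖² ψ → 0`** as `R → ∞`, for continuous integrable `ψ` (`‖∇χ_R‖² ≤ M₁` for `R ≥ 1` and `→ 0` pointwise).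
[folklore] -/
theorem tendsto_integral_gradCutoff_sq_mul {ψ : ZM → ℝ} (hψc : Continuous ψ) (hψ : Integrable ψ) :
    Tendsto (fun R : ℝ => ∫ x, ‖gradient (radialCutoff R) x‖ ^ 2 * ψ x) atTop (𝓝 0) := by
  obtain ⟨M₁, hM0, hpack⟩ := radialCutoff_package
  have hmeas : ∀ R : ℝ, 0 < R → AEStronglyMeasurable (fun x => ‖gradient (radialCutoff R) x‖ ^ 2 * ψ x) volume := by
    intro R hR
    have hχ := isTestFn_radialCutoff hR
    have hc : Continuous fun x => ∑ p, (pderiv p (radialCutoff R) x) ^ 2 :=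
      continuous_finsetSum _ fun p _ => (hχ.continuous_pderiv p).fun_pow 2
    refine ((hc.fun_mul hψc).aestronglyMeasurable).congr (ae_of_all _ fun x => ?_)
    simp only [norm_gradient_sq]
  rw [← integral_zero ZM ℝ]
  refine tendsto_integral_filter_of_dominated_convergence (fun x => M₁ * ‖ψ x‖) ?_ ?_ (hψ.norm.const_mul M₁)
    (ae_of_all _ fun x => ?_)
  · filter_upwards [eventually_ge_atTop (1 : ℝ)] with R hR
    exact hmeas R (by linarith)
  · filter_upwards [eventually_ge_atTop (1 : ℝ)] with R hR
    refine ae_of_all _ fun x => ?_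
    rw [norm_mul, Real.norm_eq_abs, abs_of_nonneg (sq_nonneg _)]
    exact mul_le_mul_of_nonneg_right ((hpack R hR).2.2.2.2 x) (norm_nonneg _)
  · refine tendsto_const_nhds.congr' ?_
    filter_upwards [eventually_ge_atTop (‖x‖ + 1)] with R hR
    have hR1 : 1 ≤ R := by linarith [norm_nonneg x]
    rw [norm_gradient_sq_eq_zero_of_eq_one (hpack R hR1).2.2.1 (show ‖x‖ < R by linarith), zero_mul]

/-! ### §2. Energy and mass of a cut-off span (general `C²` family) -/

section Span

variable {n : ℕ} {g : Fin (n + 1) → ZM → ℝ} {χ : ZM → ℝ}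

/-- A continuous weight vanishing off the support of a test function has compact support. [folklore] -/
theorem hasCompactSupport_of_eq_zero_off (hχ : IsTestFn χ) {w : ZM → ℝ}
    (hw0 : ∀ x, x ∉ tsupport χ → w x = 0) : HasCompactSupport w :=
  HasCompactSupport.intro hχ.2 hw0

/-- **Bilinear expansion against a compactly supported weight**: for continuous `f_i, h_j` and a continuous weight `w`
vanishing off `tsupport χ`, `∫ w (Σ a_i f_i)(Σ b_j h_j) = Σ_i Σ_j a_i b_j ∫ w f_i h_j`. [folklore] -/
theorem integral_weight_span_span₂ (hχ : IsTestFn χ) {w : ZM → ℝ} (hw : Continuous w)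
    (hw0 : ∀ x, x ∉ tsupport χ → w x = 0) {f h : Fin (n + 1) → ZM → ℝ} (hf : ∀ i, Continuous (f i))
    (hh : ∀ j, Continuous (h j)) (a b : Fin (n + 1) → ℝ) :
    ∫ x, w x * ((∑ i, a i * f i x) * ∑ j, b j * h j x) = ∑ i, ∑ j, a i * b j * ∫ x, w x * (f i x * h j x) := by
  have hws := hasCompactSupport_of_eq_zero_off hχ hw0
  have I : ∀ i j, Integrable fun x => a i * b j * (w x * (f i x * h j x)) := fun i j =>
    ((hw.mul ((hf i).mul (hh j))).integrable_of_hasCompactSupport hws.mul_right).const_mul _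
  have e : ∀ x, w x * ((∑ i, a i * f i x) * ∑ j, b j * h j x) = ∑ i, ∑ j, a i * b j * (w x * (f i x * h j x)) := by
    intro x
    rw [Finset.sum_mul_sum, Finset.mul_sum]
    refine Finset.sum_congr rfl fun i _ => ?_
    rw [Finset.mul_sum]
    exact Finset.sum_congr rfl fun j _ => by ring
  simp_rw [e]
  rw [integral_finsetSum _ fun i _ => integrable_finsetSum _ fun j _ => I i j]
  refine Finset.sum_congr rfl fun i _ => ?_
  rw [integral_finsetSum _ fun j _ => I i j]
  exact Finset.sum_congr rfl fun j _ => integral_const_mul _ _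

/-- **Energy of a cut-off span** (Agmon's localisation identity, bilinear form): for `C²` functions `g_j` and a test
function `χ`, `𝔮(χ Σ a_j g_j) = Σ_i Σ_j a_i a_j (∫ χ² g_i 𝔥g_j + ½ ∫ ‖∇χ‖² g_i g_j)`. [cite: Agmon1982, (1.16)] -/
theorem energyForm_cutoff_span (hχ : IsTestFn χ) (hg : ∀ j, ContDiff ℝ 2 (g j)) (a : Fin (n + 1) → ℝ) :
    energyForm (χ * fun x => ∑ j, a j * g j x) =
      ∑ i, ∑ j, a i * a j * ((∫ x, χ x ^ 2 * (g i x * hApply (g j) x))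
        + (1 / 2 : ℝ) * ∫ x, ‖gradient χ x‖ ^ 2 * (g i x * g j x)) := by
  have hgc : ∀ j, Continuous (g j) := fun j => (hg j).continuous
  have hHc : ∀ j, Continuous (hApply (g j)) := fun j => by
    have h1 : Continuous fun x => ∑ p, pderiv p (pderiv p (g j)) x :=
      continuous_finsetSum _ fun p _ => continuous_pderiv_pderiv_of_contDiff_two (hg j) p p
    have e : hApply (g j) = fun x => -(1 / 2 : ℝ) * (∑ p, pderiv p (pderiv p (g j)) x) + luscherPotential x * g j x := by
      funext x; rw [hApply_def, laplacian_def]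
    rw [e]
    exact (continuous_const.fun_mul h1).fun_add (continuous_luscherPotential.fun_mul (hgc j))
  rw [energyForm_testFn_mul hχ (contDiff_sum_mul hg a)]
  -- the `𝔥`-term
  have e1 : ∫ x, χ x ^ 2 * ((∑ j, a j * g j x) * (-(1 / 2 : ℝ) *
        (∑ p, pderiv p (pderiv p (fun y => ∑ j, a j * g j y)) x) + luscherPotential x * ∑ j, a j * g j x)) =
      ∫ x, χ x ^ 2 * ((∑ i, a i * g i x) * ∑ j, a j * hApply (g j) x) := by
    refine integral_congr_ae (Eventually.of_forall fun x => ?_)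
    show χ x ^ 2 * ((∑ j, a j * g j x) * (-(1 / 2 : ℝ) *
        (∑ p, pderiv p (pderiv p (fun y => ∑ j, a j * g j y)) x) + luscherPotential x * ∑ j, a j * g j x)) =
      χ x ^ 2 * ((∑ i, a i * g i x) * ∑ j, a j * hApply (g j) x)
    rw [← laplacian_def, ← hApply_def, hApply_sum_mul hg a x]
  have hw1 : Continuous fun x => χ x ^ 2 := hχ.continuous.fun_pow 2
  have hw10 : ∀ x, x ∉ tsupport χ → χ x ^ 2 = 0 := fun x hx => by simp [image_eq_zero_of_notMem_tsupport hx]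
  have hw2 : Continuous fun x => ‖gradient χ x‖ ^ 2 := by
    have hc : Continuous fun x => ∑ p, (pderiv p χ x) ^ 2 :=
      continuous_finsetSum _ fun p _ => (hχ.continuous_pderiv p).fun_pow 2
    exact hc.congr fun x => (norm_gradient_sq χ x).symm
  have hw20 : ∀ x, x ∉ tsupport χ → ‖gradient χ x‖ ^ 2 = 0 := fun x hx => by
    rw [norm_gradient_sq]; simp [pderiv_eq_zero_of_notMem_tsupport hx]
  have e2 : ∫ x, ‖gradient χ x‖ ^ 2 * (∑ j, a j * g j x) ^ 2 =
      ∫ x, ‖gradient χ x‖ ^ 2 * ((∑ i, a i * g i x) * ∑ j, a j * g j x) :=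
    integral_congr_ae (Eventually.of_forall fun x => by simp only [sq])
  rw [e1, e2, integral_weight_span_span₂ hχ hw1 hw10 hgc hHc a a, integral_weight_span_span₂ hχ hw2 hw20 hgc hgc a a,
    Finset.mul_sum, ← Finset.sum_add_distrib]
  refine Finset.sum_congr rfl fun i _ => ?_
  rw [Finset.mul_sum, ← Finset.sum_add_distrib]
  refine Finset.sum_congr rfl fun j _ => ?_
  ring

/-- The cut-off span of `C²` invariant functions is an admissible invariant trial function (`R > 0`).
[cite: ReedSimonIV1978, Thm. XIII.2] -/
theorem isTestFn_isGaugeInv_cutoff_span {R : ℝ} (hR : 0 < R) (hg : ∀ j, ContDiff ℝ 2 (g j))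
    (hinv : ∀ j, IsGaugeInv (g j)) (a : Fin (n + 1) → ℝ) :
    IsTestFn (radialCutoff R * fun x => ∑ j, a j * g j x) ∧ IsGaugeInv (radialCutoff R * fun x => ∑ j, a j * g j x) := by
  have hχ := isTestFn_radialCutoff hR
  refine ⟨⟨hχ.1.mul (contDiff_sum_mul hg a), hχ.2.mul_right⟩, fun M hM x => ?_⟩
  simp only [Pi.mul_apply]
  rw [isGaugeInv_radialCutoff R M hM x]
  congr 1
  exact Finset.sum_congr rfl fun j _ => by rw [hinv j M hM x]

end Span

/-! ### §3. The cut-off lemma -/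

/-- `Σ_i Σ_j |a_i||a_j| ≤ (n+1) Σ_j a_j²` (local copy of the AbsLowerPrep lemma, to keep the import cone flat). [folklore] -/
private theorem sum_abs_mul_abs_le_aux {n : ℕ} (a : Fin (n + 1) → ℝ) :
    ∑ i, ∑ j, |a i| * |a j| ≤ (n + 1) * ∑ j, a j ^ 2 := by
  have h := sq_sum_le_card_mul_sum_sq (s := (Finset.univ : Finset (Fin (n + 1)))) (f := fun j => |a j|)
  simp only [Finset.card_univ, Fintype.card_fin, sq_abs] at h
  rw [← Finset.sum_mul_sum, ← sq]
  exact_mod_cast h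

/-- Perturbation of a quadratic form by entries of size `≤ δ`: `|Σ_ij a_i a_j (A_ij − B_ij)| ≤ δ (n+1) Σ a_j²`. [folklore] -/
theorem abs_sum_sub_le_of_entries {n : ℕ} {A B : Fin (n + 1) → Fin (n + 1) → ℝ} {δ : ℝ}
    (h : ∀ i j, |A i j - B i j| ≤ δ) (a : Fin (n + 1) → ℝ) :
    |(∑ i, ∑ j, a i * a j * A i j) - ∑ i, ∑ j, a i * a j * B i j| ≤ δ * ((n + 1) * ∑ j, a j ^ 2) := by
  have hδ : 0 ≤ δ := (abs_nonneg _).trans (h 0 0)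
  rw [← Finset.sum_sub_distrib]
  simp_rw [← Finset.sum_sub_distrib, ← mul_sub]
  refine (Finset.abs_sum_le_sum_abs _ _).trans ?_
  calc ∑ i, |∑ j, a i * a j * (A i j - B i j)| ≤ ∑ i, ∑ j, |a i| * |a j| * δ := by
        refine Finset.sum_le_sum fun i _ => (Finset.abs_sum_le_sum_abs _ _).trans (Finset.sum_le_sum fun j _ => ?_)
        rw [abs_mul, abs_mul]
        exact mul_le_mul_of_nonneg_left (h i j) (by positivity)
    _ = δ * ∑ i, ∑ j, |a i| * |a j| := by
        rw [Finset.mul_sum]; refine Finset.sum_congr rfl fun i _ => ?_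
        rw [Finset.mul_sum]; exact Finset.sum_congr rfl fun j _ => by ring
    _ ≤ δ * ((n + 1) * ∑ j, a j ^ 2) := mul_le_mul_of_nonneg_left (sum_abs_mul_abs_le_aux a) hδ

/-- **THE CUT-OFF LEMMA (G5).**  Let `g_0, …, g_n ∈ IsKacFn` be `L²`-orthonormal and suppose the energy matrix
`Q_ij = ∫ g_i · 𝔥 g_j` satisfies `Σ_ij a_i a_j Q_ij ≤ s · Σ_i a_i²` for every coefficient vector (`0 ≤ s`).  Then
`physLevel (n+1) ≤ s`.  (Min–max door for NON-compactly-supported admissible families: cut off with `χ_R`, let `R → ∞`.)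
[cite: ReedSimonIV1978, Thm. XIII.1–2] -/
theorem physLevel_le_of_family {n : ℕ} (g : Fin (n + 1) → ZM → ℝ) (hg : ∀ i, IsKacFn (g i))
    (horth : ∀ i j, ∫ x, g i x * g j x = if i = j then (1 : ℝ) else 0) {s : ℝ} (hs0 : 0 ≤ s)
    (hs : ∀ a : Fin (n + 1) → ℝ, ∑ i, ∑ j, a i * a j * ∫ x, g i x * hApply (g j) x ≤ s * ∑ i, a i ^ 2) :
    physLevel (n + 1) ≤ s := by
  have hg2 : ∀ j, ContDiff ℝ 2 (g j) := fun j => (hg j).contDiff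
  have hgc : ∀ j, Continuous (g j) := fun j => (hg j).continuous
  -- matrices and their limits
  set Q : Fin (n + 1) → Fin (n + 1) → ℝ := fun i j => ∫ x, g i x * hApply (g j) x with hQ
  set D : Fin (n + 1) → Fin (n + 1) → ℝ := fun i j => if i = j then (1 : ℝ) else 0 with hD
  set QR : ℝ → Fin (n + 1) → Fin (n + 1) → ℝ := fun R i j =>
    (∫ x, radialCutoff R x ^ 2 * (g i x * hApply (g j) x))
      + (1 / 2 : ℝ) * ∫ x, ‖gradient (radialCutoff R) x‖ ^ 2 * (g i x * g j x) with hQR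
  set GR : ℝ → Fin (n + 1) → Fin (n + 1) → ℝ := fun R i j => ∫ x, radialCutoff R x ^ 2 * (g i x * g j x) with hGR
  have hHc : ∀ j, Continuous (hApply (g j)) := fun j => by
    have h1 : Continuous fun x => ∑ p, pderiv p (pderiv p (g j)) x :=
      continuous_finsetSum _ fun p _ => continuous_pderiv_pderiv_of_contDiff_two (hg2 j) p p
    have e : hApply (g j) = fun x => -(1 / 2 : ℝ) * (∑ p, pderiv p (pderiv p (g j)) x) + luscherPotential x * g j x := by
      funext x; rw [hApply_def, laplacian_def]
    rw [e]
    exact (continuous_const.fun_mul h1).fun_add (continuous_luscherPotential.fun_mul (hgc j))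
  have hlimQ : ∀ i j, Tendsto (fun R => QR R i j) atTop (𝓝 (Q i j)) := by
    intro i j
    have h1 := tendsto_integral_radialCutoff_sq_mul (φ := fun x => g i x * hApply (g j) x)
      ((hgc i).fun_mul (hHc j)) ((hg i).integrable_mul_hApply (hg j))
    have h2 := tendsto_integral_gradCutoff_sq_mul (ψ := fun x => g i x * g j x)
      ((hgc i).fun_mul (hgc j)) ((hg i).integrable_mul (hg j))
    have h := h1.add (h2.const_mul (1 / 2 : ℝ))
    rw [mul_zero, add_zero] at h
    exact h
  have hlimG : ∀ i j, Tendsto (fun R => GR R i j) atTop (𝓝 (D i j)) := by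
    intro i j
    have h := tendsto_integral_radialCutoff_sq_mul (φ := fun x => g i x * g j x)
      ((hgc i).fun_mul (hgc j)) ((hg i).integrable_mul (hg j))
    rw [horth i j] at h
    exact h
  -- ε-argument
  refine le_of_forall_pos_le_add fun ε hε => ?_
  set δ : ℝ := ε / ((n + 1) * (1 + s + ε)) with hδ
  have hn1 : (0 : ℝ) < n + 1 := by positivity
  have hδpos : 0 < δ := by positivity
  have hδn : δ * (n + 1) = ε / (1 + s + ε) := by
    rw [hδ]; field_simp
  have hδn1 : δ * (n + 1) < 1 := by
    rw [hδn, div_lt_one (by positivity)]; linarith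
  -- choose R
  have hev : ∀ᶠ R : ℝ in atTop, 1 ≤ R ∧ (∀ i j, |QR R i j - Q i j| ≤ δ) ∧ ∀ i j, |GR R i j - D i j| ≤ δ := by
    refine (eventually_ge_atTop (1 : ℝ)).and ((eventually_all.2 fun i => eventually_all.2 fun j => ?_).and
      (eventually_all.2 fun i => eventually_all.2 fun j => ?_))
    · have h := (hlimQ i j).sub_const (Q i j)
      rw [sub_self] at h
      have h' := h.abs
      rw [abs_zero] at h'
      exact (h'.eventually (ge_mem_nhds hδpos))
    · have h := (hlimG i j).sub_const (D i j)
      rw [sub_self] at h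
      have h' := h.abs
      rw [abs_zero] at h'
      exact (h'.eventually (ge_mem_nhds hδpos))
  obtain ⟨R, hR1, hQRδ, hGRδ⟩ := hev.exists
  have hR0 : 0 < R := lt_of_lt_of_le one_pos hR1
  have hχ := isTestFn_radialCutoff hR0
  -- energy and mass bounds on the cut-off span
  have hEn : ∀ a : Fin (n + 1) → ℝ, energyForm (radialCutoff R * fun x => ∑ j, a j * g j x) ≤
      (s + δ * (n + 1)) * ∑ j, a j ^ 2 := by
    intro a
    rw [energyForm_cutoff_span hχ hg2 a]
    have h1 := abs_sum_sub_le_of_entries (A := QR R) (B := Q) (hQRδ) a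
    have h2 := hs a
    have h3 := (abs_le.1 h1).2
    show ∑ i, ∑ j, a i * a j * QR R i j ≤ (s + δ * (n + 1)) * ∑ j, a j ^ 2
    nlinarith [h2, h3]
  have hMass : ∀ a : Fin (n + 1) → ℝ, (1 - δ * (n + 1)) * ∑ j, a j ^ 2 ≤
      l2sq (radialCutoff R * fun x => ∑ j, a j * g j x) := by
    intro a
    rw [l2sq_testFn_mul_span hχ hgc a]
    have h1 := abs_sum_sub_le_of_entries (A := GR R) (B := D) (hGRδ) a
    have h3 := (abs_le.1 h1).1
    have hDsum : ∑ i, ∑ j, a i * a j * D i j = ∑ j, a j ^ 2 := by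
      refine Finset.sum_congr rfl fun i _ => ?_
      rw [Finset.sum_eq_single i (fun j _ hji => by rw [hD]; simp [Ne.symm hji]) (fun h => (h (Finset.mem_univ i)).elim)]
      simp [hD, sq]
    show (1 - δ * (n + 1)) * ∑ j, a j ^ 2 ≤ ∑ i, ∑ j, a i * a j * GR R i j
    nlinarith [h3, hDsum]
  -- the Rayleigh bound with constant `s + ε`
  have hRay : ∀ a : Fin (n + 1) → ℝ, energyForm (radialCutoff R * fun x => ∑ j, a j * g j x) ≤
      (s + ε) * l2sq (radialCutoff R * fun x => ∑ j, a j * g j x) := by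
    intro a
    have hA : 0 ≤ ∑ j, a j ^ 2 := Finset.sum_nonneg fun j _ => sq_nonneg _
    have h1 := hEn a
    have h2 := hMass a
    have hpos : 0 < 1 - δ * (n + 1) := by linarith
    -- `(s + δ(n+1)) ≤ (s + ε)(1 − δ(n+1))`
    have hkey : s + δ * (n + 1) ≤ (s + ε) * (1 - δ * (n + 1)) := by
      rw [hδn]
      have h1se : 0 < 1 + s + ε := by positivity
      rw [show (s + ε) * (1 - ε / (1 + s + ε)) = (s + ε) * (1 + s) / (1 + s + ε) by field_simp; ring]
      rw [show s + ε / (1 + s + ε) = (s * (1 + s + ε) + ε) / (1 + s + ε) by field_simp]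
      rw [div_le_div_iff_of_pos_right h1se]
      nlinarith
    have hsε : 0 ≤ s + ε := by positivity
    calc energyForm (radialCutoff R * fun x => ∑ j, a j * g j x) ≤ (s + δ * (n + 1)) * ∑ j, a j ^ 2 := h1
      _ ≤ (s + ε) * (1 - δ * (n + 1)) * ∑ j, a j ^ 2 := mul_le_mul_of_nonneg_right hkey hA
      _ = (s + ε) * ((1 - δ * (n + 1)) * ∑ j, a j ^ 2) := by ring
      _ ≤ (s + ε) * l2sq (radialCutoff R * fun x => ∑ j, a j * g j x) := mul_le_mul_of_nonneg_left h2 hsε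
  -- the trial space as the range of a linear map
  let T : (Fin (n + 1) → ℝ) →ₗ[ℝ] (ZM → ℝ) :=
    { toFun := fun a => radialCutoff R * fun x => ∑ j, a j * g j x
      map_add' := fun a b => by
        funext x
        simp only [Pi.mul_apply, Pi.add_apply, add_mul, Finset.sum_add_distrib, mul_add]
      map_smul' := fun c a => by
        funext x
        simp only [Pi.mul_apply, Pi.smul_apply, smul_eq_mul, RingHom.id_apply, mul_assoc, ← Finset.mul_sum]
        ring }
  have hT : ∀ a, T a = radialCutoff R * fun x => ∑ j, a j * g j x := fun a => rfl
  have hinj : Function.Injective T := by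
    intro a b hab
    have h0 : T (a - b) = 0 := by rw [map_sub, hab, sub_self]
    by_contra hne
    have hne' : a - b ≠ 0 := sub_ne_zero.2 hne
    have hpos : 0 < ∑ j, (a - b) j ^ 2 := by
      obtain ⟨j, hj⟩ : ∃ j, (a - b) j ≠ 0 := by
        by_contra h; push Not at h; exact hne' (funext h)
      exact lt_of_lt_of_le (by positivity) (Finset.single_le_sum (fun j _ => sq_nonneg ((a - b) j)) (Finset.mem_univ j))
    have h2 := hMass (a - b)
    rw [← hT, h0] at h2
    have hl : l2sq (0 : ZM → ℝ) = 0 := by simp [l2sq]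
    rw [hl] at h2
    have : 0 < (1 - δ * (n + 1)) * ∑ j, (a - b) j ^ 2 := mul_pos (by linarith) hpos
    linarith
  have hfin : Module.finrank ℝ (LinearMap.range T) = n + 1 := by
    rw [LinearMap.finrank_range_of_inj hinj]; simp
  have hmem : s + ε ∈ levelSet (n + 1) := by
    refine ⟨LinearMap.range T, hfin, fun ψ hψ => ?_, fun ψ hψ => ?_⟩
    · obtain ⟨a, rfl⟩ := LinearMap.mem_range.1 hψ
      exact isTestFn_isGaugeInv_cutoff_span hR0 hg2 (fun j => (hg j).gaugeInv) a
    · obtain ⟨a, rfl⟩ := LinearMap.mem_range.1 hψ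
      exact hRay a
  exact physLevel_le_of_mem (Nat.succ_le_succ (Nat.zero_le n)) hmem

end Summit.QuantumFields.YangMills.Theorems.FemtoTransferGap

end
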